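import Mathlib
import HarnessLib
import Summits.NavierStokesRegularity.NavierStokesRegularity.Theorems.UnthreadedDoorCellFluxDefs
import Summits.NavierStokesRegularity.NavierStokesRegularity.Theorems.UnthreadedDoorCellFluxClusterFluxLeVorticity
import Summits.NavierStokesRegularity.NavierStokesRegularity.Theorems.UnthreadedDoorNetFluxNearCentreFlux

/-!
# Route `UnthreadedDoor`, crux `PoloidalLiouville` (stmt-NavierStokesRegularity-1222), WALL W1 — crux idea «cell-flux», support toward
# Σ-0bR₂ `ClusterFluxNearCentreLipschitz`: NEAR-CENTRE KINEMATICS OF A FROZEN CLASS (NF-6 (b),(c) for every direction set)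

Σ-0bR₂ (`Theorems/UnthreadedDoorCellFluxWindowDecayDefs.lean`, p726325) asks the `r`- and `t`-Lipschitz control of the cluster flux
`a ↦ a · Σ_{K ∈ 𝒞 t a} osc_K T(t)` of an admissible rule with NF-6's constants (`κ a₀` on `(0,a₀)`, `κ a² |t − t'|`).  NF-6
(`NetFlux.nearCentreFlux`, p668552) is the one-class case `K = S_a(x₀)`.  This file proves the same two bounds for EVERY FROZEN CLASS, i.e. for
the oscillation of `T(t)` over an ARBITRARY nonempty direction set `A ⊆ S²` transported rigidly (`x₀ + a·A`) — the pattern-free dynamic half of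
the envelope principle: whatever the rule does, between re-grouping events each class, followed rigidly, obeys NF-6.

* `setOsc_le_setOsc_add_of_sub_le`, `abs_setOsc_sub_setOsc_le` — the oscillation over a set is 1-Lipschitz for the oscillation seminorm of the
  difference: `|osc_K f − osc_K g| ≤ sup_{p,q ∈ K} |(f − g)(q) − (f − g)(p)|`;
* `abs_setOsc_dirSlice_sub_le_radius` — two radii, one class: `|osc_A T(x₀ + ρ·) − osc_A T(x₀ + ρ'·)| ≤ π L |ρ − ρ'|` for every nonempty
  `A ⊆ S²`, `ρ, ρ' ∈ (0,1]`, `‖D curl v‖ ≤ L` on `B̄(x₀,1)` (great circle on `S²` for `Ψ(ζ) = T(x₀+ρζ) − T(x₀+ρ'ζ)`, `∇Ψ × ζ = ω(x₀+ρζ) − ω(x₀+ρ'ζ)`,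
  as in `NetFlux.sphOsc_sub_sphOsc_le_radius`, p667987);
* `abs_setOsc_sub_setOsc_le_of_norm_curl_sub_le'` — one radius, two fields: `|osc_B T − osc_B T'| ≤ π K` for every nonempty `B ⊆ S_a(x₀)` when
  `‖curl v − curl v'‖ ≤ K` on `S_a(x₀)`;
* `setOsc_dirSlice_le` — growth: `osc_A T(x₀ + ρ·) ≤ π L ρ`;
* ★ `frozenClass_nearCentre` — for linked smooth window data (NF-6's binder block) there is `κ = π(2L + M) ≥ 0` such that for all `a₀ ∈ (0,1]`:
  `r ↦ r · osc_A T(t)(x₀ + r·)` is `(κ a₀)`-Lipschitz on `(0,a₀)` for every `t ∈ [t₁,t₂]` and every nonempty `A ⊆ S²`, and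
  `|a·osc_B T(t) − a·osc_B T(t')| ≤ κ a² |t − t'|` for every nonempty `B ⊆ S_a(x₀)`, `a ∈ (0,a₀)` — the conclusion of Σ-0bR₂, class by class,
  for rigidly transported classes.

What remains OPEN of Σ-0bR₂ after this and the companion files (`…LipschitzSelection` p733168, `…NearCentreLipschitzSheetFree` p733197,
`…ClassOscCritical`): relating the rule's classes at nearby parameters (re-grouping / reconnection events) — by `…ClassOscCritical` the class
boundaries are critical curves, so to first order a class may be followed rigidly.

HONEST LABEL: support lemmas strictly below W1; Σ-0bR₂, the cell-flux chain, `PoloidalLiouville` ⟨1222⟩, W1 and NS regularity are OPEN — NOT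
proved.  `--supports stmt-NavierStokesRegularity-1222 --as helper`.  [folklore]
-/

noncomputable section

-- the summit and its single sub-problem share the name (CONVENTIONS §1)
set_option linter.dupNamespace false

open Set Function Filter Topology InnerProductSpace MeasureTheory
open scoped RealInnerProductSpace ContDiff

namespace Summit.NavierStokesRegularity.NavierStokesRegularity.Theorems.PoloidalLiouville.CellFlux

open Summit.NavierStokesRegularity.NavierStokesRegularity.Theorems.PoloidalLiouville.NetFlux
  (E3 sphSup sphInf sphOsc netFlux ne_center_of_mem_sphere center_add_smul_ne continuousOn_sphere_of_continuousOn_compl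
   bddAbove_image_sphere sub_le_pi_mul_of_norm_cross_gradient_le cross_smul_sub_smul_left cross_sub_left'
   sphOsc_le_of_fderiv_curl_le contDiff_slice_of_window contDiffOn_slice_compl exists_bound_fderiv_curl exists_bound_curl_sub_curl)
open Literature.Analysis Literature.Analysis.FluidPDE

/-! ### The oscillation over a set is 1-Lipschitz for the oscillation seminorm of the difference -/

/-- **`osc_K f ≤ osc_K g + D`** whenever `(f − g)(q) − (f − g)(p) ≤ D` for all `p, q ∈ K` (`K` nonempty, `g` bounded on `K`). [folklore] -/
theorem setOsc_le_setOsc_add_of_sub_le {f g : E3 → ℝ} {K : Set E3} {D : ℝ} (hne : K.Nonempty)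
    (hga : BddAbove (g '' K)) (hgb : BddBelow (g '' K))
    (hD : ∀ p ∈ K, ∀ q ∈ K, (f q - g q) - (f p - g p) ≤ D) :
    setOsc f K ≤ setOsc g K + D := by
  set S : ℝ := setOsc g K + D with hS
  have hpq : ∀ p ∈ K, ∀ q ∈ K, f q ≤ f p + S := by
    intro p hp q hq
    have h1 : g q ≤ sSup (g '' K) := le_csSup hga (mem_image_of_mem g hq)
    have h2 : sInf (g '' K) ≤ g p := csInf_le hgb (mem_image_of_mem g hp)
    have h3 := hD p hp q hq
    simp only [hS, setOsc]
    linarith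
  obtain ⟨p₀, hp₀⟩ := hne
  have hfa : BddAbove (f '' K) := ⟨f p₀ + S, by rintro _ ⟨q, hq, rfl⟩; exact hpq p₀ hp₀ q hq⟩
  have hfb : BddBelow (f '' K) := ⟨f p₀ - S, by rintro _ ⟨q, hq, rfl⟩; linarith [hpq q hq p₀ hp₀]⟩
  have hneK : (f '' K).Nonempty := ⟨f p₀, mem_image_of_mem f hp₀⟩
  -- `sSup (f '' K) ≤ f p + S` for every `p ∈ K`, hence `sSup − S ≤ sInf`
  have hsup : ∀ p ∈ K, sSup (f '' K) ≤ f p + S := fun p hp =>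
    csSup_le hneK (by rintro _ ⟨q, hq, rfl⟩; exact hpq p hp q hq)
  have hinf : sSup (f '' K) - S ≤ sInf (f '' K) :=
    le_csInf hneK (by rintro _ ⟨p, hp, rfl⟩; linarith [hsup p hp])
  simp only [setOsc]
  linarith

/-- **`|osc_K f − osc_K g| ≤ D`** whenever `|(f − g)(q) − (f − g)(p)| ≤ D` for all `p, q ∈ K` (`K` nonempty, `f`, `g` bounded on `K`). [folklore] -/
theorem abs_setOsc_sub_setOsc_le {f g : E3 → ℝ} {K : Set E3} {D : ℝ} (hne : K.Nonempty)
    (hfa : BddAbove (f '' K)) (hfb : BddBelow (f '' K)) (hga : BddAbove (g '' K)) (hgb : BddBelow (g '' K))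
    (hD : ∀ p ∈ K, ∀ q ∈ K, |(f q - g q) - (f p - g p)| ≤ D) :
    |setOsc f K - setOsc g K| ≤ D := by
  have h₁ := setOsc_le_setOsc_add_of_sub_le hne hga hgb fun p hp q hq => (le_abs_self _).trans (hD p hp q hq)
  have h₂ := setOsc_le_setOsc_add_of_sub_le (f := g) (g := f) hne hfa hfb fun p hp q hq => by
    have h := hD p hp q hq
    rw [abs_le] at h
    linarith [h.1]
  rw [abs_le]
  constructor <;> linarith

/-! ### Two radii, one class: rigid radial transport of a direction set -/

/-- The dilated slice `ζ ↦ T(x₀ + σ ζ)` is `C¹` off the origin for `T ∈ C¹` off `x₀`, `σ > 0`. [folklore] -/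
theorem contDiffOn_dirSlice {T : E3 → ℝ} {x₀ : E3} (hT : ContDiffOn ℝ 1 T ({x₀}ᶜ)) {σ : ℝ} (hσ : 0 < σ) :
    ContDiffOn ℝ 1 (fun ζ : E3 => T (x₀ + σ • ζ)) ({0}ᶜ) := by
  have hm : MapsTo (fun ζ : E3 => x₀ + σ • ζ) ({0}ᶜ) ({x₀}ᶜ) := by
    intro ζ hζ h0
    simp only [mem_singleton_iff, add_eq_left, smul_eq_zero] at h0
    exact h0.elim (fun h => hσ.ne' h) (fun h => hζ h)
  exact hT.comp (contDiffOn_const.add (contDiffOn_id.const_smul σ)) hm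

/-- The image of a nonempty subset of the unit sphere under a dilated slice of `T ∈ C¹` off `x₀` is bounded above and below. [folklore] -/
theorem bddAbove_bddBelow_dirSlice {T : E3 → ℝ} {x₀ : E3} (hT : ContDiffOn ℝ 1 T ({x₀}ᶜ)) {σ : ℝ} (hσ : 0 < σ)
    {A : Set E3} (hA : A ⊆ Metric.sphere (0 : E3) 1) :
    BddAbove ((fun ζ : E3 => T (x₀ + σ • ζ)) '' A) ∧ BddBelow ((fun ζ : E3 => T (x₀ + σ • ζ)) '' A) := by
  have hc : ContinuousOn (fun ζ : E3 => T (x₀ + σ • ζ)) (Metric.sphere (0 : E3) 1) :=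
    (contDiffOn_dirSlice hT hσ).continuousOn.mono fun ζ hζ h0 => by
      have h1 : ‖ζ‖ = 1 := by simpa using hζ
      rw [h0, norm_zero] at h1
      exact zero_ne_one h1
  exact ⟨((isCompact_sphere (0 : E3) 1).bddAbove_image hc).mono (image_mono hA),
    ((isCompact_sphere (0 : E3) 1).bddBelow_image hc).mono (image_mono hA)⟩

/-- **Two-radius comparison for a frozen class.**  For `v ∈ C²` with `curl v = ∇T × (x − x₀)`, `T ∈ C¹` off `x₀`, `‖D(curl v)‖ ≤ L` on
`B̄(x₀,1)`, `ρ, ρ' ∈ (0,1]` and every nonempty direction set `A ⊆ S²`: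
`|osc_A T(x₀ + ρ ·) − osc_A T(x₀ + ρ' ·)| ≤ π L |ρ − ρ'|` (the whole-sphere case `A = S²` is `NetFlux.abs_sphOsc_sub_sphOsc_le_radius`). [folklore] -/
theorem abs_setOsc_dirSlice_sub_le_radius {v : E3 → E3} {T : E3 → ℝ} {x₀ : E3} {L ρ ρ' : ℝ} (hv : ContDiff ℝ 2 v)
    (hT : ContDiffOn ℝ 1 T ({x₀}ᶜ)) (hrep : ∀ x, curl v x = cross (gradient T x) (x - x₀))
    (hL : ∀ x ∈ Metric.closedBall x₀ 1, ‖fderiv ℝ (curl v) x‖ ≤ L)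
    (hρ : 0 < ρ) (hρ1 : ρ ≤ 1) (hρ' : 0 < ρ') (hρ'1 : ρ' ≤ 1)
    {A : Set E3} (hA : A ⊆ Metric.sphere (0 : E3) 1) (hne : A.Nonempty) :
    |setOsc (fun ζ : E3 => T (x₀ + ρ • ζ)) A - setOsc (fun ζ : E3 => T (x₀ + ρ' • ζ)) A| ≤ Real.pi * L * |ρ - ρ'| := by
  have hω : ContDiff ℝ 1 (curl v) := contDiff_curl (n := 1) (by exact_mod_cast hv)
  set Ψ : E3 → ℝ := fun ζ => T (x₀ + ρ • ζ) - T (x₀ + ρ' • ζ) with hΨ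
  have hΨd : ContDiffOn ℝ 1 Ψ ({0}ᶜ) := (contDiffOn_dirSlice hT hρ).sub (contDiffOn_dirSlice hT hρ')
  -- `∇Ψ(ζ) × ζ = ω(x₀ + ρζ) − ω(x₀ + ρ'ζ)`, of norm `≤ L |ρ − ρ'|` (verbatim the computation of NF-6's two-radius comparison)
  have hK : ∀ ζ ∈ Metric.sphere (0 : E3) 1, ‖cross (gradient Ψ ζ) (ζ - 0)‖ ≤ L * |ρ - ρ'| := by
    intro ζ hζ
    have hζ1 : ‖ζ‖ = 1 := by simpa using hζ
    have hne' : ∀ {σ : ℝ}, 0 < σ → x₀ + σ • ζ ≠ x₀ := fun hσ => center_add_smul_ne hσ hζ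
    have hTd : ∀ {σ : ℝ}, 0 < σ → DifferentiableAt ℝ T (x₀ + σ • ζ) := fun hσ =>
      (hT.differentiableOn one_ne_zero _ (hne' hσ)).differentiableAt (isOpen_compl_singleton.mem_nhds (hne' hσ))
    have hF : ∀ {σ : ℝ}, 0 < σ →
        HasFDerivAt (fun y : E3 => T (x₀ + σ • y)) (σ • fderiv ℝ T (x₀ + σ • ζ)) ζ := by
      intro σ hσ
      have h1 : HasFDerivAt (fun y : E3 => x₀ + σ • y) (σ • ContinuousLinearMap.id ℝ E3) ζ :=
        ((hasFDerivAt_id ζ).const_smul σ).const_add x₀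
      have h2 := (hTd hσ).hasFDerivAt.comp ζ h1
      rw [ContinuousLinearMap.comp_smul, ContinuousLinearMap.comp_id] at h2
      exact h2
    have hΨg : gradient Ψ ζ = ρ • gradient T (x₀ + ρ • ζ) - ρ' • gradient T (x₀ + ρ' • ζ) := by
      have hΨ' : HasFDerivAt Ψ (ρ • fderiv ℝ T (x₀ + ρ • ζ) - ρ' • fderiv ℝ T (x₀ + ρ' • ζ)) ζ := (hF hρ).sub (hF hρ')
      unfold gradient
      rw [hΨ'.fderiv, map_sub, map_smul, map_smul]
    have hc : cross (gradient Ψ ζ) ζ = curl v (x₀ + ρ • ζ) - curl v (x₀ + ρ' • ζ) := by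
      rw [hΨg, cross_smul_sub_smul_left, hrep, hrep, add_sub_cancel_left, add_sub_cancel_left]
    have hmem : ∀ {σ : ℝ}, 0 < σ → σ ≤ 1 → x₀ + σ • ζ ∈ Metric.closedBall x₀ 1 := by
      intro σ hσ hσ1
      rw [Metric.mem_closedBall, dist_eq_norm, add_sub_cancel_left, norm_smul, Real.norm_of_nonneg hσ.le, hζ1, mul_one]
      exact hσ1
    have hmvt := (convex_closedBall x₀ 1).norm_image_sub_le_of_norm_fderiv_le
      (fun y _ => (hω.differentiable one_ne_zero) y) hL (hmem hρ' hρ'1) (hmem hρ hρ1)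
    rw [add_sub_add_left_eq_sub, ← sub_smul, norm_smul, hζ1, mul_one, Real.norm_eq_abs] at hmvt
    rw [sub_zero, hc]
    exact hmvt
  -- great circle on the unit sphere, for every pair of directions of the class
  have hD : ∀ p ∈ A, ∀ q ∈ A, |Ψ q - Ψ p| ≤ Real.pi * L * |ρ - ρ'| := by
    intro p hp q hq
    have h1 := sub_le_pi_mul_of_norm_cross_gradient_le (x₀ := (0 : E3)) (r := 1) one_pos hΨd hK (hA hp) (hA hq)
    have h2 := sub_le_pi_mul_of_norm_cross_gradient_le (x₀ := (0 : E3)) (r := 1) one_pos hΨd hK (hA hq) (hA hp)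
    rw [abs_le]
    constructor <;> nlinarith [h1, h2]
  obtain ⟨hfa, hfb⟩ := bddAbove_bddBelow_dirSlice hT hρ hA
  obtain ⟨hga, hgb⟩ := bddAbove_bddBelow_dirSlice hT hρ' hA
  exact abs_setOsc_sub_setOsc_le hne hfa hfb hga hgb fun p hp q hq => by simpa only [hΨ] using hD p hp q hq

/-- **A transported class is a dilated direction set**: `osc_{x₀ + ρ·A} T = osc_A T(x₀ + ρ ·)`. [folklore] -/
theorem setOsc_image_dirSlice (T : E3 → ℝ) (x₀ : E3) (ρ : ℝ) (A : Set E3) :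
    setOsc T ((fun ζ : E3 => x₀ + ρ • ζ) '' A) = setOsc (fun ζ : E3 => T (x₀ + ρ • ζ)) A := by
  simp only [setOsc, image_image]

/-- **Growth of a class oscillation**: `osc_A T(x₀ + ρ ·) ≤ π L ρ` for every nonempty `A ⊆ S²`, `ρ ∈ (0,1]` (the class sits inside the sphere,
whose oscillation is `≤ π L ρ` by `NetFlux.sphOsc_le_of_fderiv_curl_le`). [folklore] -/
theorem setOsc_dirSlice_le {v : E3 → E3} {T : E3 → ℝ} {x₀ : E3} {L ρ : ℝ} (hv : ContDiff ℝ 2 v)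
    (hT : ContDiffOn ℝ 1 T ({x₀}ᶜ)) (hrep : ∀ x, curl v x = cross (gradient T x) (x - x₀))
    (hL : ∀ x ∈ Metric.closedBall x₀ 1, ‖fderiv ℝ (curl v) x‖ ≤ L) (hρ : 0 < ρ) (hρ1 : ρ ≤ 1)
    {A : Set E3} (hA : A ⊆ Metric.sphere (0 : E3) 1) (hne : A.Nonempty) :
    setOsc (fun ζ : E3 => T (x₀ + ρ • ζ)) A ≤ Real.pi * L * ρ := by
  have hLρ : ∀ x ∈ Metric.closedBall x₀ ρ, ‖fderiv ℝ (curl v) x‖ ≤ L :=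
    fun x hx => hL x (Metric.closedBall_subset_closedBall hρ1 hx)
  have h1 := sphOsc_le_of_fderiv_curl_le v x₀ T hρ hv hT hrep hLρ
  -- `osc_A T(x₀ + ρ ·) = osc_{x₀ + ρ A} T ≤ osc_{S_ρ(x₀)} T`
  have hsub : (fun ζ : E3 => x₀ + ρ • ζ) '' A ⊆ Metric.sphere x₀ ρ := by
    rintro _ ⟨ζ, hζ, rfl⟩
    have hζ1 : ‖ζ‖ = 1 := by simpa using hA hζ
    rw [mem_sphere_iff_norm, add_sub_cancel_left, norm_smul, Real.norm_of_nonneg hρ.le, hζ1, mul_one]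
  have hc := continuousOn_sphere_of_continuousOn_compl hT.continuousOn hρ
  have h2 := setOsc_mono hsub (hne.image _) (bddAbove_image_sphere hc) ((isCompact_sphere x₀ ρ).bddBelow_image hc)
  rw [setOsc_image_dirSlice] at h2
  exact h2.trans h1

/-! ### One radius, two fields: a frozen class at two times -/

/-- **Two-field comparison for a frozen class**: for two toroidal representations `curl v = ∇T × (x − x₀)`, `curl v' = ∇T' × (x − x₀)`
(`T, T' ∈ C¹` off `x₀`) with `‖curl v − curl v'‖ ≤ K` on `S_a(x₀)`, `a > 0`, and every nonempty `B ⊆ S_a(x₀)`: `|osc_B T − osc_B T'| ≤ π K`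
(the whole-sphere case is `NetFlux.abs_sphOsc_sub_sphOsc_le_of_norm_curl_sub_le`). [folklore] -/
theorem abs_setOsc_sub_setOsc_le_of_norm_curl_sub_le' {v v' : E3 → E3} {T T' : E3 → ℝ} {x₀ : E3} {a K : ℝ} (ha : 0 < a)
    (hT : ContDiffOn ℝ 1 T ({x₀}ᶜ)) (hT' : ContDiffOn ℝ 1 T' ({x₀}ᶜ))
    (hrep : ∀ x, curl v x = cross (gradient T x) (x - x₀)) (hrep' : ∀ x, curl v' x = cross (gradient T' x) (x - x₀))
    (hK : ∀ x ∈ Metric.sphere x₀ a, ‖curl v x - curl v' x‖ ≤ K)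
    {B : Set E3} (hB : B ⊆ Metric.sphere x₀ a) (hne : B.Nonempty) :
    |setOsc T B - setOsc T' B| ≤ Real.pi * K := by
  set Φ : E3 → ℝ := fun y => T y - T' y with hΦ
  have hΦd : ContDiffOn ℝ 1 Φ ({x₀}ᶜ) := hT.sub hT'
  have hKΦ : ∀ x ∈ Metric.sphere x₀ a, ‖cross (gradient Φ x) (x - x₀)‖ ≤ K := by
    intro x hx
    have hxne : x ≠ x₀ := ne_center_of_mem_sphere ha hx
    have hd : ∀ {g : E3 → ℝ}, ContDiffOn ℝ 1 g ({x₀}ᶜ) → DifferentiableAt ℝ g x := fun hg =>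
      (hg.differentiableOn one_ne_zero _ hxne).differentiableAt (isOpen_compl_singleton.mem_nhds hxne)
    have hg : gradient Φ x = gradient T x - gradient T' x := by
      have hΦ' : HasFDerivAt Φ (fderiv ℝ T x - fderiv ℝ T' x) x := (hd hT).hasFDerivAt.sub (hd hT').hasFDerivAt
      unfold gradient
      rw [hΦ'.fderiv, map_sub]
    rw [hg, cross_sub_left', ← hrep, ← hrep']
    exact hK x hx
  have hD : ∀ p ∈ B, ∀ q ∈ B, |Φ q - Φ p| ≤ Real.pi * K := by
    intro p hp q hq
    have h1 := sub_le_pi_mul_of_norm_cross_gradient_le ha hΦd hKΦ (hB hp) (hB hq)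
    have h2 := sub_le_pi_mul_of_norm_cross_gradient_le ha hΦd hKΦ (hB hq) (hB hp)
    rw [abs_le]
    constructor <;> linarith
  have hc := continuousOn_sphere_of_continuousOn_compl hT.continuousOn ha
  have hc' := continuousOn_sphere_of_continuousOn_compl hT'.continuousOn ha
  exact abs_setOsc_sub_setOsc_le hne ((bddAbove_image_sphere hc).mono (image_mono hB))
    (((isCompact_sphere x₀ a).bddBelow_image hc).mono (image_mono hB)) ((bddAbove_image_sphere hc').mono (image_mono hB))
    (((isCompact_sphere x₀ a).bddBelow_image hc').mono (image_mono hB)) fun p hp q hq => by simpa only [hΦ] using hD p hp q hq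

/-! ### Assembly: NF-6 (b),(c) for every frozen class -/

/-- ★ **Near-centre kinematics of a frozen class** (NF-6's binder block; `κ = π(2L + M)` as in `NetFlux.nearCentreFlux`).  For `v` smooth on
the window slab, `T` smooth off `x₀`, `curl v(t) = ∇T(t) × (x − x₀)`: there is `κ ≥ 0` such that for every `a₀ ∈ (0,1]`,
(b') for every `t ∈ [t₁,t₂]` and every nonempty direction set `A ⊆ S²`, `r ↦ r · osc_A T(t)(x₀ + r ·)` is `(κ a₀)`-Lipschitz on `(0,a₀)`;
(c') for `t, t' ∈ [t₁,t₂]`, `a ∈ (0,a₀)` and every nonempty `B ⊆ S_a(x₀)`, `|a · osc_B T(t) − a · osc_B T(t')| ≤ κ a² |t − t'|`.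
This is the conclusion of Σ-0bR₂ for a class that is transported rigidly (no re-grouping, no boundary motion). [folklore] -/
theorem frozenClass_nearCentre (v : ℝ → E3 → E3) (x₀ : E3) (T : ℝ → E3 → ℝ) (t₀ t₁ t₂ : ℝ)
    (h01 : t₀ < t₁) (h12 : t₁ ≤ t₂) (h20 : t₂ < 0)
    (hv : ContDiffOn ℝ (⊤ : ℕ∞) (uncurry v) (Ioo t₀ 0 ×ˢ (univ : Set E3)))
    (hT : ContDiffOn ℝ (⊤ : ℕ∞) (uncurry T) (Ioo t₀ 0 ×ˢ ({x₀}ᶜ : Set E3)))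
    (hlink : ∀ t ∈ Ioo t₀ 0, ∀ x, curl (v t) x = cross (gradient (T t) x) (x - x₀)) :
    ∃ κ : ℝ, 0 ≤ κ ∧ ∀ a₀ : ℝ, 0 < a₀ → a₀ ≤ 1 →
      (∀ t ∈ Icc t₁ t₂, ∀ A ⊆ Metric.sphere (0 : E3) 1, A.Nonempty →
        LipschitzOnWith (Real.toNNReal (κ * a₀)) (fun r => r * setOsc (fun ζ : E3 => T t (x₀ + r • ζ)) A) (Ioo 0 a₀)) ∧
      (∀ t ∈ Icc t₁ t₂, ∀ t' ∈ Icc t₁ t₂, ∀ a ∈ Ioo 0 a₀, ∀ B ⊆ Metric.sphere x₀ a, B.Nonempty →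
        |a * setOsc (T t) B - a * setOsc (T t') B| ≤ κ * a ^ 2 * |t - t'|) := by
  have _h12 := h12
  obtain ⟨L, hL0, hL⟩ := exists_bound_fderiv_curl x₀ hv h01 h20
  obtain ⟨M, hM0, hM⟩ := exists_bound_curl_sub_curl hv hlink h01 h20
  have hIcc : Icc t₁ t₂ ⊆ Ioo t₀ 0 := fun s hs => ⟨h01.trans_le hs.1, lt_of_le_of_lt hs.2 h20⟩
  have h2top : (2 : WithTop ℕ∞) ≤ ((⊤ : ℕ∞) : WithTop ℕ∞) := WithTop.coe_le_coe.2 le_top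
  have h1top : (1 : WithTop ℕ∞) ≤ ((⊤ : ℕ∞) : WithTop ℕ∞) := WithTop.coe_le_coe.2 le_top
  have hvt : ∀ t ∈ Ioo t₀ 0, ContDiff ℝ 2 (v t) := fun t ht => (contDiff_slice_of_window hv ht).of_le h2top
  have hTt : ∀ t ∈ Ioo t₀ 0, ContDiffOn ℝ 1 (T t) ({x₀}ᶜ) := fun t ht => (contDiffOn_slice_compl hT ht).of_le h1top
  have hπ : 0 ≤ Real.pi := Real.pi_pos.le
  refine ⟨Real.pi * (2 * L + M), by positivity, fun a₀ ha₀ ha₀1 => ⟨fun t ht A hA hne => ?_, fun t ht t' ht' a ha B hB hne => ?_⟩⟩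
  · -- (b') radial Lipschitz bound for a frozen class
    have hLt : ∀ x ∈ Metric.closedBall x₀ 1, ‖fderiv ℝ (curl (v t)) x‖ ≤ L := fun x hx => hL t ht x hx
    refine LipschitzOnWith.of_dist_le_mul fun r hr r' hr' => ?_
    have hr1 : r ≤ 1 := hr.2.le.trans ha₀1
    have hr'1 : r' ≤ 1 := hr'.2.le.trans ha₀1
    set O : ℝ → ℝ := fun s => setOsc (fun ζ : E3 => T t (x₀ + s • ζ)) A with hO
    have hdiff : |O r - O r'| ≤ Real.pi * L * |r - r'| :=
      abs_setOsc_dirSlice_sub_le_radius (hvt t (hIcc ht)) (hTt t (hIcc ht)) (hlink t (hIcc ht)) hLt hr.1 hr1 hr'.1 hr'1 hA hne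
    have hOr : O r ≤ Real.pi * L * r :=
      setOsc_dirSlice_le (hvt t (hIcc ht)) (hTt t (hIcc ht)) (hlink t (hIcc ht)) hLt hr.1 hr1 hA hne
    have hOr0 : 0 ≤ O r := by
      obtain ⟨hba, hbb⟩ := bddAbove_bddBelow_dirSlice (hTt t (hIcc ht)) hr.1 hA
      obtain ⟨ζ, hζ⟩ := hne
      have h1 := le_csSup hba (mem_image_of_mem (fun ζ : E3 => T t (x₀ + r • ζ)) hζ)
      have h2 := csInf_le hbb (mem_image_of_mem (fun ζ : E3 => T t (x₀ + r • ζ)) hζ)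
      simp only [hO, setOsc]
      linarith
    rw [Real.dist_eq, Real.dist_eq, Real.coe_toNNReal _ (by positivity)]
    -- `|r O(r) − r' O(r')| ≤ |r − r'| O(r) + r' |O(r) − O(r')|`
    have hsplit : r * O r - r' * O r' = (r - r') * O r + r' * (O r - O r') := by ring
    calc |r * O r - r' * O r'| = |(r - r') * O r + r' * (O r - O r')| := by rw [hsplit]
      _ ≤ |(r - r') * O r| + |r' * (O r - O r')| := abs_add_le _ _
      _ = |r - r'| * O r + r' * |O r - O r'| := by
          rw [abs_mul, abs_mul, abs_of_nonneg hOr0, abs_of_nonneg hr'.1.le]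
      _ ≤ |r - r'| * (Real.pi * L * r) + r' * (Real.pi * L * |r - r'|) :=
          add_le_add (mul_le_mul_of_nonneg_left hOr (abs_nonneg _)) (mul_le_mul_of_nonneg_left hdiff hr'.1.le)
      _ = Real.pi * L * (r + r') * |r - r'| := by ring
      _ ≤ Real.pi * (2 * L + M) * a₀ * |r - r'| := by
          have h1 : r + r' ≤ 2 * a₀ := by linarith [hr.2, hr'.2]
          have h2 : Real.pi * L * (r + r') ≤ Real.pi * L * (2 * a₀) := mul_le_mul_of_nonneg_left h1 (by positivity)
          have h3 : Real.pi * (2 * L + M) * a₀ - Real.pi * L * (2 * a₀) = Real.pi * M * a₀ := by ring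
          have h4 : 0 ≤ Real.pi * M * a₀ := by positivity
          exact mul_le_mul_of_nonneg_right (by linarith) (abs_nonneg _)
  · -- (c') temporal bound for a frozen class
    have ha1 : a ≤ 1 := ha.2.le.trans ha₀1
    have hK : ∀ x ∈ Metric.sphere x₀ a, ‖curl (v t) x - curl (v t') x‖ ≤ M * a * |t - t'| := by
      intro x hx
      have hxa : ‖x - x₀‖ = a := mem_sphere_iff_norm.1 hx
      have hx1 : x ∈ Metric.closedBall x₀ 1 := by
        rw [Metric.mem_closedBall, dist_eq_norm, hxa]; exact ha1
      have h := hM t ht t' ht' x hx1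
      rwa [hxa] at h
    have hdiff := abs_setOsc_sub_setOsc_le_of_norm_curl_sub_le' ha.1 (hTt t (hIcc ht)) (hTt t' (hIcc ht'))
      (hlink t (hIcc ht)) (hlink t' (hIcc ht')) hK hB hne
    rw [← mul_sub, abs_mul, abs_of_nonneg ha.1.le]
    calc a * |setOsc (T t) B - setOsc (T t') B| ≤ a * (Real.pi * (M * a * |t - t'|)) :=
          mul_le_mul_of_nonneg_left hdiff ha.1.le
      _ = Real.pi * M * a ^ 2 * |t - t'| := by ring
      _ ≤ Real.pi * (2 * L + M) * a ^ 2 * |t - t'| := by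
          have h1 : Real.pi * M ≤ Real.pi * (2 * L + M) := by nlinarith
          have h2 : 0 ≤ a ^ 2 * |t - t'| := by positivity
          nlinarith

end Summit.NavierStokesRegularity.NavierStokesRegularity.Theorems.PoloidalLiouville.CellFlux

end
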